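import Summits.CriticalPhenomena.SAWScalingLimit.Theorems.SAWRenewalTightnessTightOfShellCrossing

/-!
# `ShellCrossingBound`, line `socket-comparison`, stub S1 `stub_travCount`: coarse meshes are free

Crux item `stmt-CriticalPhenomena-4728` (`SAWRenewalTightness.ShellCrossingBound`), registered
stub `stub_travCount` (`TravCountBound` of the line skeleton): for a fixed inner radius `ρ > 0`
and a mesh floor `δ₁ > 0` there is a number `N = N(ρ, δ₁)` such that NO self-avoiding lattice
polyline of mesh `δ ≥ δ₁` (any domain `Ω`, any endpoints, any centre `x`, any outer radius
`R > ρ`) makes `N` separate traversals of the shell `D(x; ρ, R)`.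

This is the quantitative short-distance cutoff of Aizenman–Burchard (AB99 §1.a), already
mechanised for `ρ ≤ δ` as `not_hasTraversals_domainSAW`; here the `7 × 7` box is replaced by the
box of half-width `n = ⌈ρ/δ₁⌉₊ + 2` about the site nearest to `x`: an edge of `δℤ²` meeting
`B̄(x, ρ)` has both ends within `ρ + δ ≤ (ρ/δ₁ + 1) δ` of `x`, hence (by
`Literature.Probability.Percolation.abs_sub_nearestSite_le`) coordinatewise within `n` lattice units
of `nearestSite δ x`; a path uses each of the `≤ (2n+1)⁴` ordered pairs of box sites at most once,
and the generic engine `not_hasTraversals_toCurve_of_isPath_of_subset` bounds the traversal count by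
`2 ((2n+1)⁴ + 1) + 1 =: N`.

## References

* M. Aizenman, A. Burchard, *Hölder regularity and dimension bounds for random curves*, Duke
  Math. J. 99 (1999) 419–453, §1.a [AizenmanBurchardDuke1999].
-/

noncomputable section

open Set Metric MeasureTheory Filter Topology
open scoped unitInterval ENNReal
open Literature.Probability.RandomPlanarGeometry Literature.Probability.LatticeModels

namespace Summit.CriticalPhenomena.SAWScalingLimit.Theorems

/-! ### Lattice bookkeeping: consecutive support pairs are edges; the box of half-width `n` -/

/-- The (tail, head) pairs of the darts of a walk are the consecutive pairs of its support.
[folklore] -/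
private theorem darts_map_eq_support_zip_tail {V : Type*} {G : SimpleGraph V} :
    ∀ {u v : V} (w : G.Walk u v),
      w.darts.map (fun d ↦ (d.fst, d.snd)) = w.support.zip w.support.tail
  | _, _, .nil => by simp
  | _, _, .cons h w => by
    rw [SimpleGraph.Walk.darts_cons, List.map_cons, SimpleGraph.Walk.support_cons, List.tail_cons,
      darts_map_eq_support_zip_tail w]
    obtain ⟨t, ht⟩ : ∃ t, w.support = _ :: t := ⟨w.support.tail, w.cons_tail_support.symm⟩
    rw [ht]
    rfl

/-- A consecutive pair of the support of a walk is an edge of the graph. [folklore] -/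
private theorem adj_of_mem_support_zip_tail {V : Type*} {G : SimpleGraph V} {u v : V}
    (w : G.Walk u v) {p : V × V} (hp : p ∈ w.support.zip w.support.tail) : G.Adj p.1 p.2 := by
  rw [← darts_map_eq_support_zip_tail] at hp
  obtain ⟨d, -, rfl⟩ := List.mem_map.1 hp
  exact d.adj

/-- The `(2n+1) × (2n+1)` box of sites about `c` has at most `(2n+1)²` elements. [folklore] -/
theorem card_siteBoxN_le (c : Site 2) (n : ℕ) :
    (((Finset.Icc (c 0 - n) (c 0 + n)) ×ˢ (Finset.Icc (c 1 - n) (c 1 + n))).image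
      (fun q : ℤ × ℤ ↦ (![q.1, q.2] : Site 2))).card ≤ (2 * n + 1) ^ 2 := by
  refine Finset.card_image_le.trans ?_
  have h0 : (c 0 + n + 1 - (c 0 - n)).toNat = 2 * n + 1 := by omega
  have h1 : (c 1 + n + 1 - (c 1 - n)).toNat = 2 * n + 1 := by omega
  rw [Finset.card_product, Int.card_Icc, Int.card_Icc, h0, h1, sq]

/-- Sites coordinatewise within `n` of `c` belong to the `(2n+1) × (2n+1)` box about `c`.
[folklore] -/
theorem mem_siteBoxN {c v : Site 2} {n : ℕ} (h : ∀ i, |v i - c i| ≤ n) :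
    v ∈ ((Finset.Icc (c 0 - n) (c 0 + n)) ×ˢ (Finset.Icc (c 1 - n) (c 1 + n))).image
      (fun q : ℤ × ℤ ↦ (![q.1, q.2] : Site 2)) := by
  rw [Finset.mem_image]
  refine ⟨(v 0, v 1), ?_, ?_⟩
  · have h0 := abs_le.1 (h 0)
    have h1 := abs_le.1 (h 1)
    simp only [Finset.mem_product, Finset.mem_Icc]
    omega
  · ext j
    fin_cases j <;> rfl

/-! ### The short-distance cutoff at a mesh floor -/

/-- **Short-distance cutoff for self-avoiding polylines of mesh at least `δ₁`**: a self-avoiding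
walk of `Ω_δ ⊆ δℤ²` with `δ₁ ≤ δ`, drawn as the polyline through its mesh points, traverses no shell
`D(x; ρ, R)` (`0 < ρ < R`) by `2 ((2n+1)²·(2n+1)² + 1) + 1` separate segments, `n = ⌈ρ/δ₁⌉₊ + 2`:
an edge of `δℤ²` meeting `B̄(x, ρ)` has both ends within `ρ + δ ≤ (ρ/δ₁ + 1) δ` of `x`, hence in
the box of half-width `n` about the site nearest to `x`, and a path uses each edge at most once.
(AB99 §1.a: "a SAW uses each of the boundedly many edges near `x` at most once".)
[cite: AizenmanBurchardDuke1999, §1.a] -/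
theorem not_hasTraversals_domainSAW_of_le_mesh {ρ δ₁ : ℝ} (hρ : 0 < ρ) (hδ₁ : 0 < δ₁)
    {Ω : Set ℂ} {δ : ℝ} {u v : Site 2} (γ : SAW.DomainSAW Ω δ u v) {x : ℂ} {R : ℝ}
    (hδ₁δ : δ₁ ≤ δ) (hρR : ρ < R) :
    ¬ (⟨γ.walk.toCurve (meshPoint δ)⟩ : Curve ℂ).HasTraversals
      (2 * ((2 * (⌈ρ / δ₁⌉₊ + 2) + 1) ^ 2 * (2 * (⌈ρ / δ₁⌉₊ + 2) + 1) ^ 2 + 1) + 1) x ρ R := by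
  classical
  have hδ : 0 < δ := hδ₁.trans_le hδ₁δ
  set n : ℕ := ⌈ρ / δ₁⌉₊ + 2 with hn
  set c : Site 2 := nearestSite δ x with hc
  set box : Finset (Site 2) :=
    ((Finset.Icc (c 0 - n) (c 0 + n)) ×ˢ (Finset.Icc (c 1 - n) (c 1 + n))).image
      (fun q : ℤ × ℤ ↦ (![q.1, q.2] : Site 2)) with hbox
  have hcard : (box ×ˢ box).card ≤ (2 * n + 1) ^ 2 * (2 * n + 1) ^ 2 := by
    rw [Finset.card_product]
    exact Nat.mul_le_mul (card_siteBoxN_le c n) (card_siteBoxN_le c n)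
  intro htr
  refine not_hasTraversals_toCurve_of_isPath_of_subset γ.isPath (meshPoint δ) hρR (box ×ˢ box)
    (fun p hp hmeet ↦ ?_) (htr.of_le (by omega))
  -- the pair is an edge of `Ω_δ`, hence of `ℤ²`: its mesh points are at distance `δ`
  have hadj : (zdGraph 2).Adj p.1 p.2 :=
    meshGraph_le_zdGraph Ω δ
      (discreteDomainGraph_le_meshGraph Ω δ (adj_of_mem_support_zip_tail _ hp))
  have hdist : dist (meshPoint δ p.1) (meshPoint δ p.2) = δ := by
    rw [Literature.Probability.Percolation.dist_meshPoint_of_adj hadj, abs_of_pos hδ]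
  obtain ⟨z, hzseg, hzball⟩ := hmeet
  rw [mem_closedBall] at hzball
  have hz1 : dist (meshPoint δ p.1) z ≤ δ := by
    have := dist_add_dist_of_mem_segment hzseg
    linarith [dist_nonneg (x := z) (y := meshPoint δ p.2)]
  have hz2 : dist (meshPoint δ p.2) z ≤ δ := by
    have := dist_add_dist_of_mem_segment hzseg
    rw [dist_comm z] at this
    linarith [dist_nonneg (x := meshPoint δ p.1) (y := z)]
  -- `ρ + δ ≤ (ρ/δ₁ + 1) δ` since `δ₁ ≤ δ`
  have hK : ρ + δ ≤ (ρ / δ₁ + 1) * δ := by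
    have h₁ : ρ / δ₁ * δ₁ ≤ ρ / δ₁ * δ :=
      mul_le_mul_of_nonneg_left hδ₁δ (div_nonneg hρ.le hδ₁.le)
    rw [div_mul_cancel₀ ρ hδ₁.ne'] at h₁
    linarith
  have h1 : dist (meshPoint δ p.1) x ≤ (ρ / δ₁ + 1) * δ := by
    linarith [dist_triangle (meshPoint δ p.1) z x]
  have h2 : dist (meshPoint δ p.2) x ≤ (ρ / δ₁ + 1) * δ := by
    linarith [dist_triangle (meshPoint δ p.2) z x]
  have hKn : ρ / δ₁ + 1 + 1 ≤ (n : ℝ) := by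
    have := Nat.le_ceil (ρ / δ₁)
    rw [hn]
    push_cast
    linarith
  have hb1 : p.1 ∈ box := mem_siteBoxN fun i ↦ by
    have := Literature.Probability.Percolation.abs_sub_nearestSite_le hδ h1 hKn i
    rw [← hc] at this
    exact_mod_cast this
  have hb2 : p.2 ∈ box := mem_siteBoxN fun i ↦ by
    have := Literature.Probability.Percolation.abs_sub_nearestSite_le hδ h2 hKn i
    rw [← hc] at this
    exact_mod_cast this
  exact Finset.mem_product.2 ⟨hb1, hb2⟩

/-! ### The registered stub -/

/-- **S1 `stub_travCount` (`TravCountBound`): coarse meshes are free.** For a fixed inner radius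
`ρ > 0` and mesh floor `δ₁ > 0` there is `N = N(ρ, δ₁)` (namely `2 ((2n+1)⁴ + 1) + 1`,
`n = ⌈ρ/δ₁⌉₊ + 2`) such that no self-avoiding polyline of `Ω_δ`, `δ ≥ δ₁` — any domain `Ω`, any
endpoints, any centre `x`, any outer radius `R > ρ` — makes `N` separate traversals of
`D(x; ρ, R)`: the Aizenman–Burchard short-distance cutoff (AB99 §1.a) at a mesh floor.
[cite: AizenmanBurchardDuke1999, §1.a] -/
theorem stub_travCount :
    ∀ (ρ δ₁ : ℝ), 0 < ρ → 0 < δ₁ → ∃ N : ℕ, ∀ (Ω : Set ℂ) (δ : ℝ) (u v : Site 2)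
      (γ : SAW.DomainSAW Ω δ u v) (x : ℂ) (R : ℝ), δ₁ ≤ δ → ρ < R →
        ¬ (⟨γ.walk.toCurve (meshPoint δ)⟩ : Curve ℂ).HasTraversals N x ρ R := by
  intro ρ δ₁ hρ hδ₁
  exact ⟨_, fun Ω δ u v γ x R hδ₁δ hρR ↦
    not_hasTraversals_domainSAW_of_le_mesh hρ hδ₁ γ (Ω := Ω) (x := x) hδ₁δ hρR⟩

end Summit.CriticalPhenomena.SAWScalingLimit.Theorems
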